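import Summits.BirchSwinnertonDyer.Rank1Residual.Additive.BranchPAdicGrossZagierConverseNoRider
import Summits.BirchSwinnertonDyer.Rank1Residual.AdditivePotMult.X3MBranchPAdicGrossZagier
import HarnessLib

/-!
# T-O7c (vii), (M) half: RIDER-FREE converses on the potentially MULTIPLICATIVE rows — big image
# (Kato's half, n1011-p07's brick) and reducible image X3♯(M) (Wuthrich Thm. 16, n1011-p12's brick),
# EVERY odd `p` incl. `p = 3`, analytic rank one: `BSD(E,p)` ∧ branch IMC on `E♭` ∧ Delbourgo's
# (B)-clauses ⟹ `BranchPAdicGrossZagierMultAt W p Dh` with NO Schneider rider (cell `b2b-bsdres`, team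
# n1011, seat p01 GEN 2, OWNERS row T-O7c; rider-free twins of `PotMultBranchPAdicGrossZagierConverse.lean`
# (p254539) and `X3MBranchPAdicGrossZagier.lean` §2 (p256076); sibling of
# `Additive/BranchPAdicGrossZagierConverseNoRider.lean`, whose §0 is the mechanism)

HONEST FRAMING (cell `b2b-bsdres`, run/shared/lean/b2b/bsd-rank1-residual/, verbatim in every
file): prove what is provable now; shrink each hard class to its core with data; no claim beyond
stated classes. Research routes; census output = EVIDENCE / conjecture items, never a Literature
fact; RESIDUAL-MAP marks change only by signed lines. §I O7 stays OPEN; X4(M) / X3♯(M) stay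
CONSTRUCTION-SHAPED; nothing is booked; no label changes. COVERAGE (stated first, referee 1
proviso): `E = E♭ ⊗ χ_{p*}`, `E♭ = V` MULTIPLICATIVE at the ODD prime `p` (split / non-split; both
parities of `(p−1)/2`; `p = 3` INCLUDED), `E` of analytic rank `1`; big image = `ρ̄_{E,p}` onto (Kato 2004
Thm. 17.4 (3) half-eigen reading `Wuthrich2014.kato_halfEigenCharIdeal_dvd_cyclotomicPrime_of_surjective`,
published; tower of `E♭` AUTOMATIC, `PotMult.towerSurj_twist_of_surj`), reducible image = X3♯(M)
(`ClassX3M`; Wuthrich 2014 Thm. 16 `…thm16_halfEigenCharIdeal_dvd_cyclotomicPrime`, published, NO image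
hypothesis). On (M) `ℓ_p = 1` and "no CM" are AUTOMATIC. NO definition, NO Literature fact, NO `_holds`;
theorems only. CAVEAT (p10, inherited): on reducible rows the Néron-normalised typed LOWER
`QuadraticBranchLowerDivisibilityAt E♭ p` is OUR conjecture (hypothesis `hc`), nothing asserted.

## What and why

The rider `hS : SchneiderConjecture Dh` of p254539 / p256076 is removable in the converse direction
(`Additive.exists_unit_pgz_of_lower_of_upper_of_bsdp_noRider`: if `Reg_p(E,Dh) = 0`, (B) clause 2 with
`BSD(E,p)` gives `ord fE ≥ 2`, the UPPER identity forces `ϖ·[T¹]B = 0`, and the typed identity is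
`0 = 0`). Files: `PotMult.` / `ClassX4M.branchPAdicGrossZagierMultAt_of_bsdp_of_quadraticBranchLower_of_
katoHalf_noRider`, `ClassX3M.branchPAdicGrossZagierMultAt_of_bsdp_of_quadraticBranchLower_of_wuthrichHalf_
noRider`. So on EVERY O7-ord semistable-twist row type, `BSD(E,p)` ALONE (mod branch IMC + (B)) implies
the typed branch `p`-adic Gross–Zagier for EVERY (B)-datum; the rider stays only in the other direction
(honest: with `Reg_p = 0` the typed identity carries no `#Ш` information).

References: [Delbourgo2002] Thm. (B) (p. 40), Hypothesis p. 39; [Kato2004Asterisque] Thm. 17.4 (3);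
[Wuthrich2014] Thm. 16, §3, Cor. 19, Lemma 20; [GreenbergLNM1716] §5; [Miller2011LMS] Def. 1.1.
-/

noncomputable section

open scoped Classical MatrixGroups ModularForm NumberField

open CongruenceSubgroup WeierstrassCurve NumberField Literature.NumberTheory.EllipticCurves
  Literature.NumberTheory.EllipticCurves.ModularForms
  Literature.NumberTheory.EllipticCurves.Rank1Residual
  Literature.NumberTheory.EllipticCurves.Rank1Residual.Typed
  Literature.NumberTheory.EllipticCurves.Delbourgo2002
  Literature.NumberTheory.GaloisRepresentations
  IsDedekindDomain

namespace Summit.BirchSwinnertonDyer.Rank1Residual.AdditivePotMult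

open Additive

variable {W : WeierstrassCurve ℚ} [W.IsElliptic] [W.IsGloballyMinimal] {p : ℕ} [hp : Fact p.Prime]

/-! ### §1 Big image: (M) ∩ {`ρ̄_{E,p}` onto}, rider-free -/

omit [W.IsGloballyMinimal] in
/-- **RIDER-FREE CONVERSE ((M), rank one, EVERY odd `p` incl. `3`).** `PotMult W p`, `ρ̄_{E,p}` onto,
`r_an = 1`, `Dh` ANY height datum with Delbourgo's (B)-clauses: `BSD(E,p)` ∧ p10's LOWER
`QuadraticBranchLowerDivisibilityAt V p` for every multiplicative twist model (`hc`) ∧ Kato's half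
(`hK`, published, via n1011-p07's brick `isTorsion_and_exists_iota_eq_of_katoHalf`) ⟹
`BranchPAdicGrossZagierMultAt W p Dh` — p254539 without `hS`. [cite: Delbourgo2002, Theorem (B) (p. 40)]
[cite: Kato2004Asterisque, Thm. 17.4 (3) (p. 273)] [cite: Wuthrich2014, §3 (p. 390), Lemma 20 (p. 399)]
[cite: GreenbergLNM1716, §5 (PDF p. 143)] [cite: Miller2011LMS, Def. 1.1] -/
theorem PotMult.branchPAdicGrossZagierMultAt_of_bsdp_of_quadraticBranchLower_of_katoHalf_noRider
    (hK : Wuthrich2014.kato_halfEigenCharIdeal_dvd_cyclotomicPrime_of_surjective)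
    (hmod : hasEntireLFunction_rat) {Dh : PAdicHeightData W p}
    (hB : LeadingTermClauses W p Dh) (hpm : PotMult W p)
    (hsurj : Surj W p) (hr : W.analyticRank = 1) (hbsd : BSDp W p)
    (hc : ∀ (V : WeierstrassCurve ℚ) [V.IsElliptic] [V.IsGloballyMinimal],
      (∃ C : VariableChange ℚ, C • V.quadraticTwist ((-1) ^ (p / 2) * p : ℚ) = W) →
        QuadraticBranchLowerDivisibilityAt V p) :
    BranchPAdicGrossZagierMultAt W p Dh := by
  intro V _ _ N _ f B hp2 hVW hVB hf ϖ hϖ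
  have hna : ReductionNonAnomalous W p := hpm.reductionNonAnomalous
  obtain ⟨C, hC⟩ := hVW
  obtain ⟨κ, γ, hκ, hγ, hγ', D, fE, hcharE⟩ := exists_cyclotomic_dualData_generator W p
  haveI : Module.Finite (IwasawaAlgebra p) D.X :=
    SelmerDualData.module_finite_of_isCyclotomic (W := W) (κ := κ) hκ D hγ
  -- UPPER (Kato's half, full series, p07's brick); the tower of `E♭` from surj(p)
  have hsurjV : ∀ n : ℕ, V.HasSurjectiveModNGaloisRep (p ^ n : ℕ) :=
    hpm.towerSurj_twist_of_surj hp2 hsurj V C hC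
  obtain ⟨hXt, g, hg, u, hι⟩ := isTorsion_and_exists_iota_eq_of_katoHalf hK hp2 V C hC hsurjV hκ hγ hγ'
    hf D B (Or.inr hVB) ϖ hϖ
  -- LOWER (p10's `E♭`-level conjecture, pulled back along additive-p2's descent)
  haveI hcycL : IsCyclotomicExtension {p} ℚ (CyclotomicField p ℚ) := by
    have h : (CyclotomicField.algebra p ℚ : Algebra ℚ (CyclotomicField p ℚ)) =
        DivisionRing.toRatAlgebra := Subsingleton.elim _ _
    exact h ▸ CyclotomicField.isCyclotomicExtension p ℚ
  obtain ⟨K, θ, hK2, hθ, hθ2⟩ := exists_intermediateField_sq_eq_pStar p (CyclotomicField p ℚ) hp2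
  haveI : NumberField K := NumberField.of_module_finite ℚ K
  haveI : IsGalois ℚ K := isGalois_of_finrank_eq_two K hK2
  haveI := normal_galRange K hK2 (sigmaQ_ne_one K hK2 hθ hθ2)
  haveI := normal_galRange_cyclotomic p (CyclotomicField p ℚ)
  haveI : (V.quadraticTwist ((-1 : ℚ) ^ (p / 2) * p)).IsElliptic :=
    V.isElliptic_quadraticTwist (pStar_ne_zero p)
  obtain ⟨γ₁, hγ₁KF, hκγ₁, ⟨g₀, hg₀, hγ₁eq⟩, D', hchar', -⟩ :=
    SelmerDualData.exists_chiEigenInCyclotomic p (CyclotomicField p ℚ) V K hK2 hθ hθ2 κ hC hp2 D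
  have hmem : fE ∈ Literature.NumberTheory.EllipticCurves.Module.charIdeal (IwasawaAlgebra p) D'.X := by
    rw [hchar', hcharE]
    exact Ideal.mem_span_singleton_self fE
  obtain ⟨h, hlow⟩ := hc V ⟨C, hC⟩ K (CyclotomicField p ℚ) (κ := κ) (γ := γ₁) (f := f) B hp2 hK2
    ⟨θ, hθ2⟩ (Or.inr hVB) hκ (isTopGenerator_of_kappa_eq κ hκγ₁ hγ)
    (isCyclotomicVariable_of_eq_mul p κ hκ hg₀ hγ₁eq hγ') (Subgroup.mem_inf.mp hγ₁KF).1
    (Subgroup.mem_inf.mp hγ₁KF).2 hf D' ϖ hϖ fE hmem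
  exact exists_unit_pgz_of_lower_of_upper_of_bsdp_noRider hp2 hmod hr hbsd hB hna hκ hγ hγ' D hXt hcharE hg
    hι hlow

omit [W.IsGloballyMinimal] in
/-- **Class form, X4(M) ∩ {`ρ̄_{E,p}` onto}, EVERY odd `p`, `r_an = 1` — rider-free.**
[cite: Delbourgo2002, Theorem (B) (p. 40)] [cite: Kato2004Asterisque, Thm. 17.4 (3) (p. 273)]
[cite: Miller2011LMS, Def. 1.1] -/
theorem ClassX4M.branchPAdicGrossZagierMultAt_of_bsdp_of_quadraticBranchLower_of_katoHalf_noRider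
    (hK : Wuthrich2014.kato_halfEigenCharIdeal_dvd_cyclotomicPrime_of_surjective)
    (hmod : hasEntireLFunction_rat) (hX : ClassX4M W p) (hsurj : Surj W p) (hr : W.analyticRank = 1)
    (hbsd : BSDp W p)
    (hc : ∀ (V : WeierstrassCurve ℚ) [V.IsElliptic] [V.IsGloballyMinimal],
      (∃ C : VariableChange ℚ, C • V.quadraticTwist ((-1) ^ (p / 2) * p : ℚ) = W) →
        QuadraticBranchLowerDivisibilityAt V p)
    {Dh : PAdicHeightData W p} (hB : LeadingTermClauses W p Dh) :
    BranchPAdicGrossZagierMultAt W p Dh :=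
  (ClassX4M.potMult W p hX).branchPAdicGrossZagierMultAt_of_bsdp_of_quadraticBranchLower_of_katoHalf_noRider
    hK hmod hB hsurj hr hbsd hc

/-! ### §2 Reducible image: X3♯(M), rider-free -/

/-- **RIDER-FREE CONVERSE on X3♯(M) (reducible `E[p]`), EVERY odd `p` incl. `3`, rank one.** `BSD(E,p)`
∧ (B)-clauses for `Dh` ∧ p10's LOWER on every multiplicative twist model ∧ Wuthrich's half (`hW16`,
published, NO image hypothesis; n1011-p12's brick) ⟹ `BranchPAdicGrossZagierMultAt W p Dh` — p256076's
converse without `hS`. NO surjectivity / tower / CM / hna binder. [cite: Wuthrich2014, Thm. 16 (p. 397)]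
[cite: Delbourgo2002, Theorem (B) (p. 40)] [cite: GreenbergLNM1716, §5 (PDF p. 143)]
[cite: Miller2011LMS, Def. 1.1] -/
theorem ClassX3M.branchPAdicGrossZagierMultAt_of_bsdp_of_quadraticBranchLower_of_wuthrichHalf_noRider
    (hW16 : Wuthrich2014.thm16_halfEigenCharIdeal_dvd_cyclotomicPrime)
    (hmod : hasEntireLFunction_rat) (hX : ClassX3M W p) (hr : W.analyticRank = 1) (hbsd : BSDp W p)
    (hc : ∀ (V : WeierstrassCurve ℚ) [V.IsElliptic] [V.IsGloballyMinimal],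
      (∃ C : VariableChange ℚ, C • V.quadraticTwist ((-1) ^ (p / 2) * p : ℚ) = W) →
        QuadraticBranchLowerDivisibilityAt V p)
    {Dh : PAdicHeightData W p} (hB : LeadingTermClauses W p Dh) :
    BranchPAdicGrossZagierMultAt W p Dh := by
  intro V _ _ N _ f B hp2 hVW hVB hf ϖ hϖ
  have hna : ReductionNonAnomalous W p := hX.potMult.reductionNonAnomalous
  obtain ⟨C, hC⟩ := hVW
  have hirrV : ¬ V.HasIrreducibleModPGaloisRep p := fun hVirr ↦
    hX.classX3.1 ((irr_iff_of_model_twist (W := V) (p := p) (pStar_ne_zero p) ⟨C, hC⟩).mpr hVirr)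
  obtain ⟨κ, γ, hκ, hγ, hγ', D, fE, hcharE⟩ := exists_cyclotomic_dualData_generator W p
  haveI : Module.Finite (IwasawaAlgebra p) D.X :=
    SelmerDualData.module_finite_of_isCyclotomic (W := W) (κ := κ) hκ D hγ
  -- UPPER (Wuthrich's half on the multiplicative branch of `E♭`, full series; NO tower)
  obtain ⟨hXt, g, hg, u, hι⟩ := isTorsion_and_exists_iota_eq_of_wuthrichHalf hW16 hp2 V C hC hirrV hκ
    hγ hγ' hf D B (Or.inr hVB) ϖ hϖ
  -- LOWER (p10's `E♭`-level conjecture, pulled back along additive-p2's descent)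
  haveI hcycL : IsCyclotomicExtension {p} ℚ (CyclotomicField p ℚ) := by
    have h : (CyclotomicField.algebra p ℚ : Algebra ℚ (CyclotomicField p ℚ)) =
        DivisionRing.toRatAlgebra := Subsingleton.elim _ _
    exact h ▸ CyclotomicField.isCyclotomicExtension p ℚ
  obtain ⟨K, θ, hK2, hθ, hθ2⟩ := exists_intermediateField_sq_eq_pStar p (CyclotomicField p ℚ) hp2
  haveI : NumberField K := NumberField.of_module_finite ℚ K
  haveI : IsGalois ℚ K := isGalois_of_finrank_eq_two K hK2
  haveI := normal_galRange K hK2 (sigmaQ_ne_one K hK2 hθ hθ2)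
  haveI := normal_galRange_cyclotomic p (CyclotomicField p ℚ)
  haveI : (V.quadraticTwist ((-1 : ℚ) ^ (p / 2) * p)).IsElliptic :=
    V.isElliptic_quadraticTwist (pStar_ne_zero p)
  obtain ⟨γ₁, hγ₁KF, hκγ₁, ⟨g₀, hg₀, hγ₁eq⟩, D', hchar', -⟩ :=
    SelmerDualData.exists_chiEigenInCyclotomic p (CyclotomicField p ℚ) V K hK2 hθ hθ2 κ hC hp2 D
  have hmem : fE ∈ Literature.NumberTheory.EllipticCurves.Module.charIdeal (IwasawaAlgebra p) D'.X := by
    rw [hchar', hcharE]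
    exact Ideal.mem_span_singleton_self fE
  obtain ⟨h, hlow⟩ := hc V ⟨C, hC⟩ K (CyclotomicField p ℚ) (κ := κ) (γ := γ₁) (f := f) B hp2 hK2
    ⟨θ, hθ2⟩ (Or.inr hVB) hκ (isTopGenerator_of_kappa_eq κ hκγ₁ hγ)
    (isCyclotomicVariable_of_eq_mul p κ hκ hg₀ hγ₁eq hγ') (Subgroup.mem_inf.mp hγ₁KF).1
    (Subgroup.mem_inf.mp hγ₁KF).2 hf D' ϖ hϖ fE hmem
  exact exists_unit_pgz_of_lower_of_upper_of_bsdp_noRider hp2 hmod hr hbsd hB hna hκ hγ hγ' D hXt hcharE hg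
    hι hlow

end Summit.BirchSwinnertonDyer.Rank1Residual.AdditivePotMult

end
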